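import Summits.ResolutionOfSingularities.ResolutionOfSingularities.Theorems.WildConesCampaignW46ForcedAtomExitBoundAll
import Summits.ResolutionOfSingularities.ResolutionOfSingularities.Theorems.WildConesCampaignW46TjurinaMilnor
import Summits.ResolutionOfSingularities.ResolutionOfSingularities.Theorems.WildConesCampaignW46ForcedAtomWitness
import Summits.ResolutionOfSingularities.ResolutionOfSingularities.Theorems.WildConesClassicalRegimesStubMuDropCharTwoOrdPLeaves
import HarnessLib

/-!
# [OURS · L1 W4.6, rung (i) WITH A NUMBER — brick 23] The exit bound is THE MILNOR NUMBER OF THE POINT (a canonical `β`),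
# and its value on the K4.6 cusp family: at most `n − 1` centres over the origin of `y^p + x^n`
# (cell res-hironaka, LADDER-RESOLUTION rung L, D-0089; slot W4.6, seat res-L1-s46-pv-2 gen 4; host route `WildCones`,
# crux `ClassicalRegimes` stmt-ResolutionOfSingularities-16884, `--supports … --as helper`)

HONEST FRAMING. Everything here is OURS. NOTHING below is a statement of H. Hironaka's manuscript [Hironaka2017]; o1's
`FinLocalExitBound` clause and `Regime.forcedAtom` enter as DEFINITIONS; no FACT-LIST premise. AI review is weaker than
expert review.

## What is proved

The `β` of o1's `FinLocalExitBound` is existentially quantified, and this seat's witnesses (p524336, brick 22 p537008) were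
built from a CHOSEN presentation. Here the bound is made canonical:

* `ForcedAtom.sInf_mu_eq_of_presentation` — **the Milnor number of a point**: over a perfect field, the infimum of `μ(c₀)`
  over all formal presentations `E₀(f₀) = w₀·(z^p − ser c₀)` of `J_x` equals `μ(c₀)` for EVERY presentation (brick 19
  `mu_eq_of_span_eq`, p533320).
* `ForcedAtom.exists_canonical_beta` (`K` algebraically closed, `0 < n`) — the clause of
  `FinLocalExitBound (Regime.forcedAtom n)` holds with `β(A, E, x) = μ(x) + 1`, `μ(x)` the Milnor number of the point (`0`
  at unpresented points), and `β(A, E, x) = μ(c₀) + 1` for EVERY presentation `c₀` at `x`;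
  `ForcedAtom.exists_canonical_beta_classical` — in the classical regimes `n ≤ 2 ∨ p = 2`, the same with `β = μ(x)`.
* `CuspPlane.mu_negPow` — the one-variable state `−u^{m+1}` (`p ∤ m + 1`) has `μ = m` (tree: `κ⟦u⟧/(u^m)` has
  dimension `m`, `WildCones.MuDropCharTwoOrdP.finrank_quot_X_pow`); `CuspPlane.exists_presentation_negPow` — the K4.6 cusp
  `E_n = ((y^p + x^n)·𝒪, p)` on `𝔸²_K` is presented at the origin by the state `−u^n` (p521837's Cohen coordinates).
* `CuspPlane.exists_beta_cusp_eq` — **for `K` algebraically closed of characteristic `p` there is ONE bound `β` satisfying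
  the clause of `FinLocalExitBound (Regime.forcedAtom 1)` with `β(𝔸², E_{m+1}, origin) = m` for every `m` with
  `p ∤ m + 1`**: along every finite §2.1-permissible sequence of the typed procedure inside the forced-atom regime that
  starts at the cusp `y^p + x^{m+1}`, at most `m` centres lie over the origin. (For `m + 1 = p + 1` this seat's p525587
  shows every such `β` is `≥ 1` there.)

References: bricks 19 (p533320), 22 (p537008); p521837, p525587 (cusp witnesses); res-L1-s46-pv-13
`CuspPlane.stalkIdeal_eq_span`; `WildCones.MuDropCharTwoOrdP.finrank_quot_X_pow`. [folklore]
-/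

noncomputable section

-- single-problem summit: the doubled namespace component `ResolutionOfSingularities` is forced
set_option linter.dupNamespace false

open scoped BigOperators Classical
open MvPowerSeries IsLocalRing

namespace Summit.ResolutionOfSingularities.ResolutionOfSingularities.Theorems

namespace CampaignW46.ForcedAtom

open CategoryTheory AlgebraicGeometry TopologicalSpace
open Literature.AlgebraicGeometry.Resolution
open Literature.AlgebraicGeometry.Hironaka2017.S02Preliminaries
open Literature.AlgebraicGeometry.Hironaka2017.Datum
open Scheme.IdealSheafData
open WildCones
open CampaignW46.AtomGerm

variable {p : ℕ} [Fact p.Prime] {K : Type} [Field K] [CharP K p] {n : ℕ}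

/-! ## The Milnor number of a point -/

/-- [OURS · L1 W4.6 — DICTIONARY; NOT a statement of the manuscript] **The Milnor number of a point.** Over a perfect field
`K` of characteristic `p`: for every formal presentation `E₀(f₀) = w₀·(z^p − ser c₀)` of `J_x`, the infimum of the Milnor
numbers of all presentations of `J_x` is `μ(c₀)` (all presentations have the same Milnor number, brick 19). [folklore] -/
theorem sInf_mu_eq_of_presentation [PerfectField K] {A : AmbientDatum p K} (E : IdealExponent A.Z) (x : A.Z)
    (E₀ : AdicCompletion (maximalIdeal (A.Z.presheaf.stalk x)) (A.Z.presheaf.stalk x) ≃+* MvPowerSeries (Option (Fin n)) K)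
    (f₀ : A.Z.presheaf.stalk x) (c₀ : (Fin n → ℕ) → K) (w₀ : MvPowerSeries (Option (Fin n)) K)
    (hJ : stalkIdeal E.J x = Ideal.span {f₀}) (hw : IsUnit w₀)
    (hf : E₀ (algebraMap _ _ f₀) = w₀ * ((X none : MvPowerSeries (Option (Fin n)) K) ^ p -
      rename (some : Fin n → Option (Fin n)) (ser p n K c₀))) :
    sInf {m : ℕ | ∃ (E₀ : AdicCompletion (maximalIdeal (A.Z.presheaf.stalk x)) (A.Z.presheaf.stalk x) ≃+*
          MvPowerSeries (Option (Fin n)) K)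
        (f₀ : A.Z.presheaf.stalk x) (c₀ : (Fin n → ℕ) → K) (w₀ : MvPowerSeries (Option (Fin n)) K),
        stalkIdeal E.J x = Ideal.span {f₀} ∧ IsUnit w₀ ∧
          E₀ (algebraMap _ _ f₀) = w₀ * ((X none : MvPowerSeries (Option (Fin n)) K) ^ p -
            rename (some : Fin n → Option (Fin n)) (ser p n K c₀)) ∧ m = mu p n K c₀} = mu p n K c₀ := by
  haveI : PerfectRing K p := PerfectField.toPerfectRing p
  apply le_antisymm
  · exact Nat.sInf_le ⟨E₀, f₀, c₀, w₀, hJ, hw, hf, rfl⟩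
  · refine le_csInf ⟨_, E₀, f₀, c₀, w₀, hJ, hw, hf, rfl⟩ ?_
    rintro m ⟨E₀', f₀', c₀', w₀', hJ', hw', hf', rfl⟩
    exact (mu_eq_of_span_eq E₀ E₀' f₀ f₀' c₀ c₀' w₀ w₀' (hJ.symm.trans hJ') hw hw' hf hf').le

variable [IsAlgClosed K]

/-- [OURS · L1 W4.6 rung (i) WITH A NUMBER in EVERY dimension — CANONICAL bound; NOT a statement of the manuscript] Over an
algebraically closed field of characteristic `p`, `0 < n`: the clause of `FinLocalExitBound (Regime.forcedAtom n)` holds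
with the CANONICAL bound `β(A, E, x) = μ(x) + 1` (`μ(x)` the Milnor number of the point, `β = 0 + 1`-free: `0` at
unpresented points), and `β(A, E, x) = μ(c₀) + 1` for EVERY presentation `c₀` of `J_x`. [folklore] -/
theorem exists_canonical_beta (hn : 0 < n) :
    ∃ β : ∀ A : AmbientDatum p K, IdealExponent A.Z → A.Z → ℕ,
      (∀ r : FinPermissibleRun p K, (∀ k, k ≤ r.len → Regime.forcedAtom (p := p) (K := K) n (r.A k) (r.E k)) →
        ∀ (x : (r.A 0).Z) (s : Finset ℕ),
          (∀ m ∈ s, m < r.len ∧ ∃ y ∈ (r.D m : Set (r.A m).Z), r.down m y = x) → s.card ≤ β (r.A 0) (r.E 0) x) ∧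
      ∀ (A : AmbientDatum p K) (E : IdealExponent A.Z) (x : A.Z)
        (E₀ : AdicCompletion (maximalIdeal (A.Z.presheaf.stalk x)) (A.Z.presheaf.stalk x) ≃+*
          MvPowerSeries (Option (Fin n)) K)
        (f₀ : A.Z.presheaf.stalk x) (c₀ : (Fin n → ℕ) → K) (w₀ : MvPowerSeries (Option (Fin n)) K),
        stalkIdeal E.J x = Ideal.span {f₀} → IsUnit w₀ →
          E₀ (algebraMap _ _ f₀) = w₀ * ((X none : MvPowerSeries (Option (Fin n)) K) ^ p -
            rename (some : Fin n → Option (Fin n)) (ser p n K c₀)) → β A E x = mu p n K c₀ + 1 := by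
  refine ⟨fun A E x =>
    if ∃ (E₀ : AdicCompletion (maximalIdeal (A.Z.presheaf.stalk x)) (A.Z.presheaf.stalk x) ≃+*
          MvPowerSeries (Option (Fin n)) K)
        (f₀ : A.Z.presheaf.stalk x) (c₀ : (Fin n → ℕ) → K) (w₀ : MvPowerSeries (Option (Fin n)) K),
        stalkIdeal E.J x = Ideal.span {f₀} ∧ IsUnit w₀ ∧
          E₀ (algebraMap _ _ f₀) = w₀ * ((X none : MvPowerSeries (Option (Fin n)) K) ^ p -
            rename (some : Fin n → Option (Fin n)) (ser p n K c₀))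
      then sInf {m : ℕ | ∃ (E₀ : AdicCompletion (maximalIdeal (A.Z.presheaf.stalk x)) (A.Z.presheaf.stalk x) ≃+*
          MvPowerSeries (Option (Fin n)) K)
        (f₀ : A.Z.presheaf.stalk x) (c₀ : (Fin n → ℕ) → K) (w₀ : MvPowerSeries (Option (Fin n)) K),
        stalkIdeal E.J x = Ideal.span {f₀} ∧ IsUnit w₀ ∧
          E₀ (algebraMap _ _ f₀) = w₀ * ((X none : MvPowerSeries (Option (Fin n)) K) ^ p -
            rename (some : Fin n → Option (Fin n)) (ser p n K c₀)) ∧ m = mu p n K c₀} + 1 else 0, ?_, ?_⟩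
  · intro r hr x s hs
    dsimp only
    by_cases hex : ∃ (E₀ : AdicCompletion (maximalIdeal ((r.A 0).Z.presheaf.stalk x)) ((r.A 0).Z.presheaf.stalk x) ≃+*
          MvPowerSeries (Option (Fin n)) K)
        (f₀ : (r.A 0).Z.presheaf.stalk x) (c₀ : (Fin n → ℕ) → K) (w₀ : MvPowerSeries (Option (Fin n)) K),
        stalkIdeal (r.E 0).J x = Ideal.span {f₀} ∧ IsUnit w₀ ∧
          E₀ (algebraMap _ _ f₀) = w₀ * ((X none : MvPowerSeries (Option (Fin n)) K) ^ p -
            rename (some : Fin n → Option (Fin n)) (ser p n K c₀))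
    · rw [if_pos hex]
      obtain ⟨E₀, f₀, c₀, w₀, hJ0, hw0, hf0⟩ := hex
      rw [sInf_mu_eq_of_presentation (r.E 0) x E₀ f₀ c₀ w₀ hJ0 hw0 hf0]
      exact (card_le_mu_succ_of_oneStep hn r hr (fun k hk ξ hξ hD E₁ f₁ a w hJ hw hf₁ hM _ hξ' _ hcl =>
        exists_presentation_transform_of_isBlowup (r.π k) (r.D k) (r.blowup k (Nat.lt_of_succ_lt hk))
          (r.hom_eq k (Nat.lt_of_succ_lt hk)) (hr k (Nat.lt_of_succ_lt hk).le).1 (hr k (Nat.lt_of_succ_lt hk).le).2.1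
          hξ hD ((hr k (Nat.lt_of_succ_lt hk).le).2.2 ξ hξ).1 E₁ f₁ a w hJ hw hf₁ hM hξ' hcl)
        x s hs E₀ f₀ c₀ w₀ hJ0 hw0 hf0).1
    · rw [if_neg hex]
      -- no presentation at `x`: then no centre lies over `x`
      rcases s.eq_empty_or_nonempty with hs0 | ⟨m₀, hm₀⟩
      · rw [hs0, Finset.card_empty]
      exfalso
      have hlen : 0 < r.len := lt_of_le_of_lt (Nat.zero_le m₀) (hs m₀ hm₀).1
      obtain ⟨ξ, hξ, -, hdown⟩ := exists_centres r hr hlen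
      have hx : x = ξ 0 hlen := by
        obtain ⟨hm₀len, y, hy, hyx⟩ := hs m₀ hm₀
        rw [(hξ m₀ hm₀len).1, Set.mem_singleton_iff] at hy
        rw [← hyx, hy, hdown m₀ hm₀len]
      subst hx
      have hξS : ξ 0 hlen ∈ (r.E 0).sing := by
        rw [(hξ 0 hlen).2]
        exact Set.mem_singleton _
      exact hex ((hr 0 hlen.le).2.2 (ξ 0 hlen) hξS).2.1
  · intro A E x E₀ f₀ c₀ w₀ hJ hw hf
    dsimp only
    rw [if_pos ⟨E₀, f₀, c₀, w₀, hJ, hw, hf⟩, sInf_mu_eq_of_presentation E x E₀ f₀ c₀ w₀ hJ hw hf]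

/-- [OURS · L1 W4.6 rung (i) WITH A NUMBER, classical regimes — CANONICAL bound; NOT a statement of the manuscript] In the
classical regimes `n ≤ 2 ∨ p = 2` (`0 < n`, `K` algebraically closed of characteristic `p`) the clause of
`FinLocalExitBound (Regime.forcedAtom n)` holds with the canonical bound `β(A, E, x) = μ(x)`, the Milnor number of the point
(`0` at unpresented points): `β(A, E, x) = μ(c₀)` for EVERY presentation `c₀` of `J_x`. [folklore] -/
theorem exists_canonical_beta_classical (hn : 0 < n) (hreg : n ≤ 2 ∨ p = 2) :
    ∃ β : ∀ A : AmbientDatum p K, IdealExponent A.Z → A.Z → ℕ,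
      (∀ r : FinPermissibleRun p K, (∀ k, k ≤ r.len → Regime.forcedAtom (p := p) (K := K) n (r.A k) (r.E k)) →
        ∀ (x : (r.A 0).Z) (s : Finset ℕ),
          (∀ m ∈ s, m < r.len ∧ ∃ y ∈ (r.D m : Set (r.A m).Z), r.down m y = x) → s.card ≤ β (r.A 0) (r.E 0) x) ∧
      ∀ (A : AmbientDatum p K) (E : IdealExponent A.Z) (x : A.Z)
        (E₀ : AdicCompletion (maximalIdeal (A.Z.presheaf.stalk x)) (A.Z.presheaf.stalk x) ≃+*
          MvPowerSeries (Option (Fin n)) K)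
        (f₀ : A.Z.presheaf.stalk x) (c₀ : (Fin n → ℕ) → K) (w₀ : MvPowerSeries (Option (Fin n)) K),
        stalkIdeal E.J x = Ideal.span {f₀} → IsUnit w₀ →
          E₀ (algebraMap _ _ f₀) = w₀ * ((X none : MvPowerSeries (Option (Fin n)) K) ^ p -
            rename (some : Fin n → Option (Fin n)) (ser p n K c₀)) → β A E x = mu p n K c₀ := by
  refine ⟨fun A E x =>
    sInf {m : ℕ | ∃ (E₀ : AdicCompletion (maximalIdeal (A.Z.presheaf.stalk x)) (A.Z.presheaf.stalk x) ≃+*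
          MvPowerSeries (Option (Fin n)) K)
        (f₀ : A.Z.presheaf.stalk x) (c₀ : (Fin n → ℕ) → K) (w₀ : MvPowerSeries (Option (Fin n)) K),
        stalkIdeal E.J x = Ideal.span {f₀} ∧ IsUnit w₀ ∧
          E₀ (algebraMap _ _ f₀) = w₀ * ((X none : MvPowerSeries (Option (Fin n)) K) ^ p -
            rename (some : Fin n → Option (Fin n)) (ser p n K c₀)) ∧ m = mu p n K c₀}, ?_, ?_⟩
  · intro r hr x s hs
    dsimp only
    by_cases hex : ∃ (E₀ : AdicCompletion (maximalIdeal ((r.A 0).Z.presheaf.stalk x)) ((r.A 0).Z.presheaf.stalk x) ≃+*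
          MvPowerSeries (Option (Fin n)) K)
        (f₀ : (r.A 0).Z.presheaf.stalk x) (c₀ : (Fin n → ℕ) → K) (w₀ : MvPowerSeries (Option (Fin n)) K),
        stalkIdeal (r.E 0).J x = Ideal.span {f₀} ∧ IsUnit w₀ ∧
          E₀ (algebraMap _ _ f₀) = w₀ * ((X none : MvPowerSeries (Option (Fin n)) K) ^ p -
            rename (some : Fin n → Option (Fin n)) (ser p n K c₀))
    · obtain ⟨E₀, f₀, c₀, w₀, hJ0, hw0, hf0⟩ := hex
      rw [sInf_mu_eq_of_presentation (r.E 0) x E₀ f₀ c₀ w₀ hJ0 hw0 hf0]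
      exact (card_le_mu_succ_of_oneStep hn r hr (fun k hk ξ hξ hD E₁ f₁ a w hJ hw hf₁ hM _ hξ' _ hcl =>
        exists_presentation_transform_of_isBlowup (r.π k) (r.D k) (r.blowup k (Nat.lt_of_succ_lt hk))
          (r.hom_eq k (Nat.lt_of_succ_lt hk)) (hr k (Nat.lt_of_succ_lt hk).le).1 (hr k (Nat.lt_of_succ_lt hk).le).2.1
          hξ hD ((hr k (Nat.lt_of_succ_lt hk).le).2.2 ξ hξ).1 E₁ f₁ a w hJ hw hf₁ hM hξ' hcl)
        x s hs E₀ f₀ c₀ w₀ hJ0 hw0 hf0).2 hreg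
    · -- no presentation at `x`: then no centre lies over `x`
      rcases s.eq_empty_or_nonempty with hs0 | ⟨m₀, hm₀⟩
      · rw [hs0, Finset.card_empty]
        exact Nat.zero_le _
      exfalso
      have hlen : 0 < r.len := lt_of_le_of_lt (Nat.zero_le m₀) (hs m₀ hm₀).1
      obtain ⟨ξ, hξ, -, hdown⟩ := exists_centres r hr hlen
      have hx : x = ξ 0 hlen := by
        obtain ⟨hm₀len, y, hy, hyx⟩ := hs m₀ hm₀
        rw [(hξ m₀ hm₀len).1, Set.mem_singleton_iff] at hy
        rw [← hyx, hy, hdown m₀ hm₀len]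
      subst hx
      have hξS : ξ 0 hlen ∈ (r.E 0).sing := by
        rw [(hξ 0 hlen).2]
        exact Set.mem_singleton _
      exact hex ((hr 0 hlen.le).2.2 (ξ 0 hlen) hξS).2.1
  · intro A E x E₀ f₀ c₀ w₀ hJ hw hf
    exact sInf_mu_eq_of_presentation E x E₀ f₀ c₀ w₀ hJ hw hf

end CampaignW46.ForcedAtom

/-! ## The K4.6 cusp family: `β(𝔸², (y^p + x^{m+1}), origin) = m` -/

namespace CampaignW46.CuspPlane

open CategoryTheory AlgebraicGeometry TopologicalSpace
open Literature.AlgebraicGeometry.Resolution Scheme.IdealSheafData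
open Literature.AlgebraicGeometry.Hironaka2017.S02Preliminaries
open Literature.AlgebraicGeometry.Hironaka2017.SpecOrders
open Literature.AlgebraicGeometry.Hironaka2017.S16Proof
open Literature.AlgebraicGeometry.Hironaka2017.Datum
open WildCones

variable (p : ℕ) (K : Type) [Field K]

/-- [OURS · L1 W4.6] **The Milnor number of the one-variable state `−u^{m+1}` is `m`** (`p ∤ m + 1`): its gradient
ideal is `(u^m)` (p521837) and `κ⟦u⟧/(u^m)` has dimension `m`. [folklore] -/
theorem mu_negPow [CharP K p] {m : ℕ} (hn : ¬ p ∣ m + 1) :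
    mu p 1 K (fun A : Fin 1 → ℕ => if A 0 = m + 1 then (-1 : K) else 0) = m := by
  change Module.finrank K (MvPowerSeries (Fin 1) K ⧸
    jac p 1 K (fun A : Fin 1 → ℕ => if A 0 = m + 1 then (-1 : K) else 0)) = m
  rw [jac_negPow p K hn]
  exact (MuDropCharTwoOrdP.finrank_quot_X_pow (κ := K) m).2

/-- [OURS · L1 W4.6] **The cusp `E_n = ((y^p + x^n)·𝒪, p)` on `𝔸²_K` is presented at the origin by the state `−u^n`**
(`p ∤ n`, `K` of characteristic `p`): Cohen coordinates `y ↦ z`, `x ↦ u` (p521837 `exists_presentation_origin`) carry the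
generator `(y/1)^p + (x/1)^n` of `J_ξ` to the atom `z^p − (−u^n)`. [folklore] -/
theorem exists_presentation_negPow [Fact p.Prime] [CharP K p] {n : ℕ} (hn : ¬ p ∣ n) :
    ∃ (E₀ : AdicCompletion (maximalIdeal ((U82Gap.Z K).presheaf.stalk (U82Gap.ξ K)))
          ((U82Gap.Z K).presheaf.stalk (U82Gap.ξ K)) ≃+* MvPowerSeries (Option (Fin 1)) K)
      (f₀ : (U82Gap.Z K).presheaf.stalk (U82Gap.ξ K)) (w₀ : MvPowerSeries (Option (Fin 1)) K),
      stalkIdeal (shf (MvPolynomial (Fin 2) K) (Ideal.span {MvPolynomial.X 1 ^ p + MvPolynomial.X 0 ^ n}))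
          (U82Gap.ξ K) = Ideal.span {f₀} ∧ IsUnit w₀ ∧
        E₀ (algebraMap _ _ f₀) = w₀ * ((MvPowerSeries.X none : MvPowerSeries (Option (Fin 1)) K) ^ p -
          rename (some : Fin 1 → Option (Fin 1)) (ser p 1 K (fun A : Fin 1 → ℕ => if A 0 = n then (-1 : K) else 0))) := by
  obtain ⟨E₀, h0, h1⟩ := exists_presentation_origin p K
  refine ⟨E₀, _, 1, stalkIdeal_eq_span p K n (U82Gap.ξ K), isUnit_one, ?_⟩
  simp only [map_add, map_pow, h0, h1, ser_negPow p K hn, map_neg, rename_X, one_mul, sub_neg_eq_add]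

/-- [OURS · L1 W4.6 rung (i) WITH A NUMBER — the K4.6 cusp family; replaces the role of «the procedure resolves the cusp
`y^p + x^n` in a bounded number of steps» (role only); NOT a statement of the manuscript] **Over an algebraically closed
field `K` of characteristic `p` there is ONE bound `β` satisfying the clause of `FinLocalExitBound (Regime.forcedAtom 1)`
(plane curves `z^p = a(u)`) whose value at the origin of the cusp `E_{m+1} = ((y^p + x^{m+1})·𝒪, p)` on `𝔸²_K` is EXACTLY
`m`, for every `m` with `p ∤ m + 1`**: along every finite §2.1-permissible sequence of the typed procedure inside the
forced-atom regime starting at `E_{m+1}` (which lies in the regime when `p ≤ m + 1`, p521837), at most `m` centres lie over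
the origin — the Milnor number of `−u^{m+1}`. [folklore] -/
theorem exists_beta_cusp_eq [Fact p.Prime] [CharP K p] [IsAlgClosed K] :
    ∃ β : ∀ A : AmbientDatum p K, IdealExponent A.Z → A.Z → ℕ,
      (∀ r : FinPermissibleRun p K, (∀ k, k ≤ r.len → Regime.forcedAtom (p := p) (K := K) 1 (r.A k) (r.E k)) →
        ∀ (x : (r.A 0).Z) (s : Finset ℕ),
          (∀ m ∈ s, m < r.len ∧ ∃ y ∈ (r.D m : Set (r.A m).Z), r.down m y = x) → s.card ≤ β (r.A 0) (r.E 0) x) ∧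
      ∀ m : ℕ, ¬ p ∣ m + 1 →
        β (U82Gap.amb p K)
          ⟨shf (MvPolynomial (Fin 2) K) (Ideal.span {MvPolynomial.X 1 ^ p + MvPolynomial.X 0 ^ (m + 1)}), p⟩
          (U82Gap.ξ K) = m := by
  obtain ⟨β, hβ, hval⟩ := ForcedAtom.exists_canonical_beta_classical (p := p) (K := K) (n := 1) Nat.one_pos
    (Or.inl one_le_two)
  refine ⟨β, hβ, fun m hm => ?_⟩
  obtain ⟨E₀, f₀, w₀, hJ, hw, hf⟩ := exists_presentation_negPow p K hm
  have h := hval (U82Gap.amb p K)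
    ⟨shf (MvPolynomial (Fin 2) K) (Ideal.span {MvPolynomial.X 1 ^ p + MvPolynomial.X 0 ^ (m + 1)}), p⟩
    (U82Gap.ξ K) E₀ f₀ (fun A : Fin 1 → ℕ => if A 0 = m + 1 then (-1 : K) else 0) w₀ hJ hw hf
  rw [h, mu_negPow p K hm]

end CampaignW46.CuspPlane

end Summit.ResolutionOfSingularities.ResolutionOfSingularities.Theorems

end
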